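import Summits.Parity.GeneralizedHardyLittlewood.Theorems.GreenTaoLevelTwoMNTwoTypeIBranch

/-!
# Route `GreenTaoLevelTwo`, crux `MNTwo` (stmt-Parity-21276), line `birth`, stub `stub_mnVertical`:
# the type I half of Proposition 22 at the budget scale (GT 2008b §10, Lemma 23 side)

Block H4 / R4-I (budget form) of the `stub_mnVertical` census (B. Green, T. Tao, *Quadratic
uniformity of the Möbius function*, Ann. Inst. Fourier 58 (2008) = arXiv:math/0606087, §10, the
type I case: "Now simply let `𝒟` be the set of such `d`, set `L := X/ε`, and require that
`X₀ ≲ 1` be large enough").  Def-free: the hypothesis `hI` of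
`…MNTwoPropTwentyTwoBudget.prop22_budget_of_branches` — the type I alternative of the dichotomy
at level `η ≥ c·log^{-a} N` implies the Prop-22 clause set at the scale
`ρ₁ = P^{-(k+2)(4+4^{k+2})}`, `P = log^{A₀} N`, for `A₀ ≥ A₂ = a(2A_I+2)+1` and `N ≥ N₂(A₀)` —
is discharged from `…MNTwoTypeIBranch.prop22_of_typeI` (Lemma 23 at one scale) by choosing
`ε = min(η/8, ρ)` and verifying the budget (`Q₁ ≤ P`, `8Q₁ ≤ Pε²`), size
(`4·32·38ᵏ·2^{j+1} ≤ (ρ₁/16)^{k+1}N/2`, via `log^r x = o(x^{1/2})`) and density conditions.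

* `typeI_half` — the statement just described (all torus dimensions `k`).

References: [GreenTao2008QuadraticMobius] arXiv:math/0606087 §10 (type I case), Lemma 23.
-/

noncomputable section

open Finset Real Filter Asymptotics

namespace Summit.Parity.GeneralizedHardyLittlewood.GreenTaoLevelTwoMNTwoTypeIHalf

open Summit.Parity.GeneralizedHardyLittlewood.GreenTaoLevelTwoMNTwoTypeIBranch (prop22_of_typeI)

/-- **The type I half of Proposition 22 at the budget scale (GT 2008b §10, Lemma 23 side).**
This is the hypothesis `hI` of `…MNTwoPropTwentyTwoBudget.prop22_budget_of_branches` verbatim: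
for `a, c > 0` there is `A₂` (namely `a(2A_I+2)+1`, `A_I` the exponent of Lemma 23) such that for
every `A₀ ≥ A₂` and `N ≥ N₂(A₀)`, Prop-19 data `(α, n₀, ρ, φ, ψ)` in gauge form with
`log^{-a} N ≤ ρ`, and a level `η ∈ [c·log^{-a} N, 1/2]`, the type I alternative (`d ≤ U`,
`U² ≤ N`) implies the Prop-22 clause set at `ρ₁ = P^{-(k+2)(4+4^{k+2})}`, `P = log^{A₀} N`.
[cite: GreenTao2008QuadraticMobius, §10 (type I case), Lemma 23] -/
theorem typeI_half (k : ℕ) :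
    ∀ (aη cη : ℝ), 0 < aη → 0 < cη → ∃ A₂ : ℝ, ∀ A₀ : ℝ, A₂ ≤ A₀ →
      ∃ N₂ : ℕ, ∀ N : ℕ, N₂ ≤ N → 2 ≤ N →
      ∀ (α : Fin k → ℝ) (n₀ : ℤ) (ρ : ℝ), 0 < ρ → 100000 * ρ < 1 → (Real.log N ^ aη)⁻¹ ≤ ρ →
      ∀ (φ : ℤ → UnitAddCircle),
        (∀ n a b c : ℤ,
          (⨆ i : Fin k, ‖((((n - n₀ : ℤ) : ℝ) * α i : ℝ) : AddCircle (1 : ℝ))‖) +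
              |((n - n₀ : ℤ) : ℝ)| / N < 100 * ρ →
          (⨆ i : Fin k, ‖((((n + a - n₀ : ℤ) : ℝ) * α i : ℝ) : AddCircle (1 : ℝ))‖) +
              |((n + a - n₀ : ℤ) : ℝ)| / N < 100 * ρ →
          (⨆ i : Fin k, ‖((((n + b - n₀ : ℤ) : ℝ) * α i : ℝ) : AddCircle (1 : ℝ))‖) +
              |((n + b - n₀ : ℤ) : ℝ)| / N < 100 * ρ →
          (⨆ i : Fin k, ‖((((n + c - n₀ : ℤ) : ℝ) * α i : ℝ) : AddCircle (1 : ℝ))‖) +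
              |((n + c - n₀ : ℤ) : ℝ)| / N < 100 * ρ →
          (⨆ i : Fin k, ‖((((n + a + b - n₀ : ℤ) : ℝ) * α i : ℝ) : AddCircle (1 : ℝ))‖) +
              |((n + a + b - n₀ : ℤ) : ℝ)| / N < 100 * ρ →
          (⨆ i : Fin k, ‖((((n + a + c - n₀ : ℤ) : ℝ) * α i : ℝ) : AddCircle (1 : ℝ))‖) +
              |((n + a + c - n₀ : ℤ) : ℝ)| / N < 100 * ρ →
          (⨆ i : Fin k, ‖((((n + b + c - n₀ : ℤ) : ℝ) * α i : ℝ) : AddCircle (1 : ℝ))‖) +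
              |((n + b + c - n₀ : ℤ) : ℝ)| / N < 100 * ρ →
          (⨆ i : Fin k, ‖((((n + a + b + c - n₀ : ℤ) : ℝ) * α i : ℝ) : AddCircle (1 : ℝ))‖) +
              |((n + a + b + c - n₀ : ℤ) : ℝ)| / N < 100 * ρ →
          φ (n + a + b + c) - φ (n + a + b) - φ (n + a + c) - φ (n + b + c)
            + φ (n + a) + φ (n + b) + φ (n + c) - φ n = 0) →
      ∀ (ψ : ℤ → ℝ), (∀ n, 0 ≤ ψ n) → (∀ n, ψ n ≤ 1) →
        (∀ n, ψ n ≠ 0 →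
          (⨆ i : Fin k, ‖((((n - n₀ : ℤ) : ℝ) * α i : ℝ) : AddCircle (1 : ℝ))‖) +
            |((n - n₀ : ℤ) : ℝ)| / N < ρ) →
        (∀ n, ψ n ≠ 0 → (N : ℤ) < n ∧ n ≤ 2 * N) →
        (∀ n n' : ℤ, |ψ n - ψ n'| ≤
          (⨆ i : Fin k, ‖((((n - n' : ℤ) : ℝ) * α i : ℝ) : AddCircle (1 : ℝ))‖) +
            |((n - n' : ℤ) : ℝ)| / N) →
      ∀ (η : ℝ), cη * (Real.log N ^ aη)⁻¹ ≤ η → 2 * η ≤ 1 →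
      ∀ (U j : ℕ), U * U ≤ N →
        η ^ 2 * 2 ^ j ≤ #((Icc 1 U).filter fun d => Nat.log 2 d = j ∧
          η * ((2 * N : ℕ) : ℝ) / 2 ^ j ≤
            ‖∑ w ∈ Icc 1 (2 * N / d), ((ψ ((d * w : ℕ) : ℤ) : ℝ) : ℂ) *
              (AddCircle.toCircle (φ ((d * w : ℕ) : ℤ)) : ℂ)‖) →
      ∀ ρ₁ : ℝ, ρ₁ = ((Real.log N ^ A₀) ^ ((k + 2) * (4 + 4 ^ (k + 2))))⁻¹ →
        ∃ (D : ℕ) (𝒟 : Finset ℕ), 1 ≤ D ∧ 𝒟 ⊆ Icc 1 D ∧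
          4 * (32 * 38 ^ k) * (D : ℝ) ≤ (ρ₁ / 16) ^ (k + 1) * N / 2 ∧
          ρ₁ * (D : ℝ) ^ 2 / Real.log N ^ A₀ ≤ (#𝒟 : ℝ) ^ 2 ∧
          ∀ d ∈ 𝒟, ∀ n ∈ (Finset.Ioo (-(N : ℤ)) N).filter fun n : ℤ =>
              (∀ i, ‖(((n : ℝ) * α i : ℝ) : AddCircle (1 : ℝ))‖ + |(n : ℝ)| / N < ρ₁) ∧
                |(n : ℝ)| / N < ρ₁,
            (d : ℤ) ∣ n → ∃ q : ℕ, 1 ≤ q ∧ (q : ℝ) ≤ Real.log N ^ A₀ ∧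
              ‖((q : ℤ)) • (φ (n₀ + n + n) - φ (n₀ + n) - φ (n₀ + n) + φ n₀)‖ ≤
                Real.log N ^ A₀ * ρ₁ ^ 2 := by
  classical
  obtain ⟨AI, C, hC1, hTI⟩ := prop22_of_typeI k
  intro aη cη haη hcη
  -- constants
  set c' : ℝ := min (cη / 8) 1 with hc'
  have hc'pos : 0 < c' := lt_min (by positivity) one_pos
  have hc'8 : c' ≤ cη / 8 := min_le_left _ _
  have hc'1 : c' ≤ 1 := min_le_right _ _
  set K₀ : ℝ := C * (128 / cη ^ 2) ^ AI with hK₀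
  have hC0 : 0 < C := by linarith
  have hK₀pos : 0 < K₀ := by rw [hK₀]; positivity
  refine ⟨aη * ((2 * AI + 2 : ℕ) : ℝ) + 1, ?_⟩
  intro A₀ hA₀
  have hA₀1 : aη + 1 ≤ A₀ := by
    have : aη ≤ aη * ((2 * AI + 2 : ℕ) : ℝ) := by
      have h1 : (1 : ℝ) ≤ ((2 * AI + 2 : ℕ) : ℝ) := by exact_mod_cast (by omega : 1 ≤ 2 * AI + 2)
      nlinarith
    linarith
  have hA₀pos : 0 < A₀ := by linarith
  -- the exponent of `P` in `ρ₁^{k+1}` and the size constant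
  set e₁ : ℕ := (k + 2) * (4 + 4 ^ (k + 2)) with he₁
  have he₁1 : 1 ≤ e₁ := by
    have : 0 < e₁ := by rw [he₁]; positivity
    omega
  set Kk : ℝ := 16 * (32 * 38 ^ k) * 16 ^ (k + 1) with hKk
  have hKkpos : 0 < Kk := by rw [hKk]; positivity
  have hlo := (isLittleO_log_rpow_rpow_atTop (A₀ * ((e₁ * (k + 1) : ℕ) : ℝ))
    (by norm_num : (0 : ℝ) < 1 / 2)).bound (show (0 : ℝ) < 1 / Kk by positivity)
  obtain ⟨T, hT⟩ := eventually_atTop.mp hlo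
  set M : ℝ := max 2 (max K₀ (max (8 * K₀ / c' ^ 2) (max (1 / c') (4 / cη ^ 4)))) with hM
  refine ⟨⌈max T (Real.exp M)⌉₊, ?_⟩
  intro N hN h2N α n₀ ρ hρ hρ1 hρa φ hφ ψ hψ0 hψ1 hsupp hsuppN hlip η hηc hη2 U j hUU hgood ρ₁ hρ₁
  -- thresholds at `N`
  have hN' : max T (Real.exp M) ≤ N := (Nat.le_ceil _).trans (by exact_mod_cast hN)
  have hTN : T ≤ N := (le_max_left _ _).trans hN'
  have hexpN : Real.exp M ≤ N := (le_max_right _ _).trans hN'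
  have hNpos : (0 : ℝ) < N := lt_of_lt_of_le (Real.exp_pos _) hexpN
  have hN1 : 1 ≤ N := by omega
  have hlogM : M ≤ Real.log N := by rw [Real.le_log_iff_exp_le hNpos]; exact hexpN
  have hlog2 : 2 ≤ Real.log N := le_trans (le_max_left _ _) hlogM
  have hK₀log : K₀ ≤ Real.log N := le_trans ((le_max_left _ _).trans (le_max_right _ _)) hlogM
  have hK₂ : 8 * K₀ / c' ^ 2 ≤ Real.log N :=
    le_trans ((le_max_left _ _).trans ((le_max_right _ _).trans (le_max_right _ _))) hlogM
  have h1c' : 1 / c' ≤ Real.log N :=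
    le_trans ((le_max_left _ _).trans ((le_max_right _ _).trans ((le_max_right _ _).trans
      (le_max_right _ _)))) hlogM
  have h4c : 4 / cη ^ 4 ≤ Real.log N :=
    le_trans ((le_max_right _ _).trans ((le_max_right _ _).trans ((le_max_right _ _).trans
      (le_max_right _ _)))) hlogM
  have hlog1 : 1 ≤ Real.log N := by linarith
  have hlogpos : 0 < Real.log N := by linarith
  -- `Λ = log^a N`, `P = log^{A₀} N`
  have hΛ1 : 1 ≤ Real.log N ^ aη := Real.one_le_rpow hlog1 haη.le
  have hΛpos : 0 < Real.log N ^ aη := by linarith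
  have hP1 : 1 ≤ Real.log N ^ A₀ := Real.one_le_rpow hlog1 hA₀pos.le
  have hPpos : 0 < Real.log N ^ A₀ := by linarith
  have hpowP : ∀ m : ℕ, (m : ℝ) ≤ ((2 * AI + 2 : ℕ) : ℝ) →
      (Real.log N ^ aη) ^ m * Real.log N ≤ Real.log N ^ A₀ := by
    intro m hm
    have e : Real.log N ^ (aη * (m : ℝ) + 1) = (Real.log N ^ aη) ^ m * Real.log N := by
      rw [Real.rpow_add hlogpos, Real.rpow_mul_natCast hlogpos.le, Real.rpow_one]
    rw [← e]
    apply Real.rpow_le_rpow_of_exponent_le hlog1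
    nlinarith [mul_le_mul_of_nonneg_left hm haη.le]
  -- the level `η` and the parameter `ε = min (η/8) ρ`
  have hηpos : 0 < η := lt_of_lt_of_le (by positivity) hηc
  have hηΛ : cη ≤ η * Real.log N ^ aη := by
    have := mul_le_mul_of_nonneg_right hηc hΛpos.le
    rwa [mul_assoc, inv_mul_cancel₀ hΛpos.ne', mul_one] at this
  set ε : ℝ := min (η / 8) ρ with hε
  have hεη : ε ≤ η / 8 := min_le_left _ _
  have hερ : ε ≤ ρ := min_le_right _ _
  have hεlow : c' * (Real.log N ^ aη)⁻¹ ≤ ε := by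
    refine le_min ?_ ?_
    · calc c' * (Real.log N ^ aη)⁻¹ ≤ (cη / 8) * (Real.log N ^ aη)⁻¹ :=
            mul_le_mul_of_nonneg_right hc'8 (by positivity)
        _ = cη * (Real.log N ^ aη)⁻¹ / 8 := by ring
        _ ≤ η / 8 := by linarith
    · calc c' * (Real.log N ^ aη)⁻¹ ≤ 1 * (Real.log N ^ aη)⁻¹ :=
            mul_le_mul_of_nonneg_right hc'1 (by positivity)
        _ ≤ ρ := by rw [one_mul]; exact hρa
  have hεpos : 0 < ε := lt_of_lt_of_le (by positivity) hεlow
  have hR : ρ + 5 * ε ≤ 100 * ρ := by linarith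
  have h16 : 16 * ε ≤ 2 * η := by linarith
  -- `U ≤ N`
  have hUN : U ≤ N := by
    rcases Nat.eq_zero_or_pos U with h0 | hpos
    · omega
    · exact le_trans (Nat.le_mul_of_pos_left U hpos) hUU
  -- `ρ₁`
  have hρ₁pos : 0 < ρ₁ := by rw [hρ₁]; positivity
  have hρ₁P : ρ₁ ≤ (Real.log N ^ A₀)⁻¹ := by
    rw [hρ₁]
    apply inv_anti₀ hPpos
    calc Real.log N ^ A₀ = (Real.log N ^ A₀) ^ 1 := (pow_one _).symm
      _ ≤ (Real.log N ^ A₀) ^ ((k + 2) * (4 + 4 ^ (k + 2))) :=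
          pow_le_pow_right₀ hP1 (by rw [← he₁]; exact he₁1)
  have hΛlogP : Real.log N ^ aη * Real.log N ≤ Real.log N ^ A₀ := by
    have := hpowP 1 (by exact_mod_cast (by omega : 1 ≤ 2 * AI + 2))
    rwa [pow_one] at this
  have hρ₁ε : ρ₁ ≤ ε := by
    refine hρ₁P.trans (le_trans ?_ hεlow)
    calc (Real.log N ^ A₀)⁻¹ ≤ (Real.log N ^ aη * Real.log N)⁻¹ :=
          inv_anti₀ (by positivity) hΛlogP
      _ = (Real.log N ^ aη)⁻¹ * (1 / Real.log N) := by rw [mul_inv]; ring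
      _ ≤ (Real.log N ^ aη)⁻¹ * c' := by
          refine mul_le_mul_of_nonneg_left ?_ (by positivity)
          rw [div_le_iff₀ hlogpos]
          rw [div_le_iff₀ hc'pos] at h1c'
          linarith
      _ = c' * (Real.log N ^ aη)⁻¹ := mul_comm _ _
  -- the Lemma-23 budget `Q₁ ≤ K₀ Λ^{2A_I}`
  have hQ₁ : C * (512 * 1 ^ 2 / (2 * η) ^ 2) ^ AI ≤ K₀ * (Real.log N ^ aη) ^ (2 * AI) := by
    have h1 : 512 * 1 ^ 2 / (2 * η) ^ 2 ≤ 128 / cη ^ 2 * (Real.log N ^ aη) ^ 2 := by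
      have hsq : cη ^ 2 ≤ (η * Real.log N ^ aη) ^ 2 := pow_le_pow_left₀ hcη.le hηΛ 2
      rw [div_le_iff₀ (by positivity)]
      have e : 128 / cη ^ 2 * (Real.log N ^ aη) ^ 2 * (2 * η) ^ 2 =
          512 * ((η * Real.log N ^ aη) ^ 2 / cη ^ 2) := by
        field_simp
        ring
      rw [e, one_pow, mul_one]
      have : 1 ≤ (η * Real.log N ^ aη) ^ 2 / cη ^ 2 := by
        rw [le_div_iff₀ (by positivity)]; linarith
      linarith
    calc C * (512 * 1 ^ 2 / (2 * η) ^ 2) ^ AI ≤ C * (128 / cη ^ 2 * (Real.log N ^ aη) ^ 2) ^ AI := by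
          gcongr
      _ = K₀ * (Real.log N ^ aη) ^ (2 * AI) := by rw [hK₀, mul_pow, ← pow_mul]; ring
  -- budget 1: `Q₁ ≤ P`
  have hB1 : C * (512 * 1 ^ 2 / (2 * η) ^ 2) ^ AI ≤ Real.log N ^ A₀ := by
    refine hQ₁.trans ?_
    calc K₀ * (Real.log N ^ aη) ^ (2 * AI) ≤ Real.log N * (Real.log N ^ aη) ^ (2 * AI) :=
          mul_le_mul_of_nonneg_right hK₀log (by positivity)
      _ = (Real.log N ^ aη) ^ (2 * AI) * Real.log N := mul_comm _ _
      _ ≤ Real.log N ^ A₀ := hpowP (2 * AI) (by exact_mod_cast (by omega : 2 * AI ≤ 2 * AI + 2))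
  -- budget 2: `8Q₁ ≤ P ε²`
  have hB2 : 8 * (C * (512 * 1 ^ 2 / (2 * η) ^ 2) ^ AI) ≤ Real.log N ^ A₀ * ε ^ 2 := by
    have h1 : 8 * (C * (512 * 1 ^ 2 / (2 * η) ^ 2) ^ AI) ≤
        8 * K₀ * (Real.log N ^ aη) ^ (2 * AI) := by linarith [hQ₁]
    have h2 : c' ^ 2 * (Real.log N ^ aη)⁻¹ ^ 2 ≤ ε ^ 2 := by
      have := pow_le_pow_left₀ (by positivity) hεlow 2
      rwa [mul_pow] at this
    have h3 : 8 * K₀ * (Real.log N ^ aη) ^ (2 * AI + 2) ≤ c' ^ 2 * Real.log N ^ A₀ := by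
      have h31 : 8 * K₀ ≤ c' ^ 2 * Real.log N := by
        rw [div_le_iff₀ (by positivity)] at hK₂; linarith
      calc 8 * K₀ * (Real.log N ^ aη) ^ (2 * AI + 2)
          ≤ c' ^ 2 * Real.log N * (Real.log N ^ aη) ^ (2 * AI + 2) :=
            mul_le_mul_of_nonneg_right h31 (by positivity)
        _ = c' ^ 2 * ((Real.log N ^ aη) ^ (2 * AI + 2) * Real.log N) := by ring
        _ ≤ c' ^ 2 * Real.log N ^ A₀ :=
            mul_le_mul_of_nonneg_left (hpowP (2 * AI + 2) le_rfl) (by positivity)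
    calc 8 * (C * (512 * 1 ^ 2 / (2 * η) ^ 2) ^ AI) ≤ 8 * K₀ * (Real.log N ^ aη) ^ (2 * AI) := h1
      _ = (8 * K₀ * (Real.log N ^ aη) ^ (2 * AI + 2)) * (Real.log N ^ aη)⁻¹ ^ 2 := by
          field_simp
          ring
      _ ≤ (c' ^ 2 * Real.log N ^ A₀) * (Real.log N ^ aη)⁻¹ ^ 2 :=
          mul_le_mul_of_nonneg_right h3 (by positivity)
      _ = Real.log N ^ A₀ * (c' ^ 2 * (Real.log N ^ aη)⁻¹ ^ 2) := by ring
      _ ≤ Real.log N ^ A₀ * ε ^ 2 := mul_le_mul_of_nonneg_left h2 hPpos.le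
  -- size: `2^j ≤ U ≤ √N` and `Kk · P^{e₁(k+1)} ≤ √N`
  have h2j : (2 : ℝ) ^ j ≤ U := by
    have hpos : (0 : ℝ) < η ^ 2 * 2 ^ j := by positivity
    have hcard : 0 < #((Icc 1 U).filter fun d => Nat.log 2 d = j ∧
        η * ((2 * N : ℕ) : ℝ) / 2 ^ j ≤
          ‖∑ w ∈ Icc 1 (2 * N / d), ((ψ ((d * w : ℕ) : ℤ) : ℝ) : ℂ) *
            (AddCircle.toCircle (φ ((d * w : ℕ) : ℤ)) : ℂ)‖) := by
      have := hpos.trans_le hgood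
      exact_mod_cast this
    obtain ⟨d, hd⟩ := Finset.card_pos.mp hcard
    rw [mem_filter, mem_Icc] at hd
    have hd0 : d ≠ 0 := by omega
    have h1 : 2 ^ j ≤ d := by
      have := Nat.pow_log_le_self 2 hd0
      rwa [hd.2.1] at this
    exact_mod_cast h1.trans hd.1.2
  have hUsqrt : (U : ℝ) ≤ Real.sqrt N := by
    rw [Real.le_sqrt (by positivity) (by positivity)]
    exact_mod_cast (by simpa [pow_two] using hUU)
  have hPe : (Real.log N ^ A₀) ^ (e₁ * (k + 1)) = Real.log N ^ (A₀ * ((e₁ * (k + 1) : ℕ) : ℝ)) :=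
    (Real.rpow_mul_natCast hlogpos.le A₀ (e₁ * (k + 1))).symm
  have hsizeT : Kk * (Real.log N ^ A₀) ^ (e₁ * (k + 1)) ≤ Real.sqrt N := by
    have h1 := hT N hTN
    rw [Real.norm_eq_abs, Real.norm_eq_abs, abs_of_nonneg (Real.rpow_nonneg hlogpos.le _),
      abs_of_nonneg (Real.rpow_nonneg hNpos.le _), ← Real.sqrt_eq_rpow, ← hPe] at h1
    rw [mul_comm]
    calc (Real.log N ^ A₀) ^ (e₁ * (k + 1)) * Kk ≤ 1 / Kk * Real.sqrt N * Kk :=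
          mul_le_mul_of_nonneg_right h1 hKkpos.le
      _ = Real.sqrt N := by field_simp
  have hsize : 4 * (32 * 38 ^ k) * ((2 ^ (j + 1) : ℕ) : ℝ) ≤ (ρ₁ / 16) ^ (k + 1) * N / 2 := by
    have hPepos : 0 < (Real.log N ^ A₀) ^ (e₁ * (k + 1)) := by positivity
    have key : 8 * (32 * 38 ^ k) * Real.sqrt N * (2 * 16 ^ (k + 1) *
        (Real.log N ^ A₀) ^ (e₁ * (k + 1))) ≤ (N : ℝ) := by
      calc 8 * (32 * 38 ^ k) * Real.sqrt N * (2 * 16 ^ (k + 1) * (Real.log N ^ A₀) ^ (e₁ * (k + 1)))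
          = Real.sqrt N * (Kk * (Real.log N ^ A₀) ^ (e₁ * (k + 1))) := by rw [hKk]; ring
        _ ≤ Real.sqrt N * Real.sqrt N := mul_le_mul_of_nonneg_left hsizeT (Real.sqrt_nonneg _)
        _ = N := Real.mul_self_sqrt hNpos.le
    have hstep : 4 * (32 * 38 ^ k) * ((2 ^ (j + 1) : ℕ) : ℝ) ≤ 8 * (32 * 38 ^ k) * Real.sqrt N := by
      push_cast
      calc 4 * (32 * 38 ^ k) * (2 : ℝ) ^ (j + 1) = 8 * (32 * 38 ^ k) * (2 : ℝ) ^ j := by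
            rw [pow_succ]; ring
        _ ≤ 8 * (32 * 38 ^ k) * Real.sqrt N :=
            mul_le_mul_of_nonneg_left (h2j.trans hUsqrt) (by positivity)
    refine hstep.trans ?_
    rw [hρ₁, div_pow, inv_pow, ← pow_mul]
    rw [show ((Real.log N ^ A₀) ^ (e₁ * (k + 1)))⁻¹ / 16 ^ (k + 1) * (N : ℝ) / 2 =
      (N : ℝ) / (2 * 16 ^ (k + 1) * (Real.log N ^ A₀) ^ (e₁ * (k + 1))) by
        field_simp]
    rw [le_div_iff₀ (by positivity)]
    exact key
  -- density
  have hdens : ρ₁ * ((2 ^ (j + 1) : ℕ) : ℝ) ^ 2 / Real.log N ^ A₀ ≤ (η ^ 2 * 2 ^ j) ^ 2 := by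
    have hη4 : cη ^ 4 * (Real.log N ^ aη)⁻¹ ^ 4 ≤ η ^ 4 := by
      have := pow_le_pow_left₀ (by positivity) hηc 4
      rwa [mul_pow] at this
    have e1 : ((2 ^ (j + 1) : ℕ) : ℝ) ^ 2 = 4 * ((2 : ℝ) ^ j) ^ 2 := by push_cast; ring
    rw [e1]
    have hρ₁P2 : ρ₁ / Real.log N ^ A₀ ≤ (Real.log N ^ A₀)⁻¹ * (Real.log N ^ A₀)⁻¹ := by
      rw [div_eq_mul_inv]
      exact mul_le_mul_of_nonneg_right hρ₁P (by positivity)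
    have hPP : (Real.log N ^ aη) ^ 2 * Real.log N ≤ Real.log N ^ A₀ :=
      hpowP 2 (by exact_mod_cast (by omega : 2 ≤ 2 * AI + 2))
    have hmain : 4 * ((Real.log N ^ A₀)⁻¹ * (Real.log N ^ A₀)⁻¹) ≤
        cη ^ 4 * (Real.log N ^ aη)⁻¹ ^ 4 := by
      have hsq : (Real.log N ^ aη) ^ 4 * Real.log N ^ 2 ≤ (Real.log N ^ A₀) ^ 2 := by
        calc (Real.log N ^ aη) ^ 4 * Real.log N ^ 2 = ((Real.log N ^ aη) ^ 2 * Real.log N) ^ 2 := by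
              ring
          _ ≤ (Real.log N ^ A₀) ^ 2 := pow_le_pow_left₀ (by positivity) hPP 2
      have h4' : 4 ≤ Real.log N * cη ^ 4 := by rwa [div_le_iff₀ (by positivity)] at h4c
      have h4 : 4 ≤ cη ^ 4 * Real.log N ^ 2 := by
        calc (4 : ℝ) ≤ 4 * Real.log N := by linarith
          _ ≤ (Real.log N * cη ^ 4) * Real.log N := mul_le_mul_of_nonneg_right h4' hlogpos.le
          _ = cη ^ 4 * Real.log N ^ 2 := by ring
      -- `4 P⁻² ≤ cη⁴ Λ⁻⁴` ⟸ `4 Λ⁴ ≤ cη⁴ P²`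
      have hΛ4 : 0 < (Real.log N ^ aη) ^ 4 := by positivity
      have hP2 : 0 < (Real.log N ^ A₀) ^ 2 := by positivity
      rw [show (Real.log N ^ A₀)⁻¹ * (Real.log N ^ A₀)⁻¹ = ((Real.log N ^ A₀) ^ 2)⁻¹ by
        rw [← mul_inv, pow_two], inv_pow, ← div_eq_mul_inv, ← div_eq_mul_inv,
        div_le_div_iff₀ hP2 hΛ4]
      calc 4 * (Real.log N ^ aη) ^ 4 ≤ cη ^ 4 * Real.log N ^ 2 * (Real.log N ^ aη) ^ 4 :=
            mul_le_mul_of_nonneg_right h4 hΛ4.le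
        _ = cη ^ 4 * ((Real.log N ^ aη) ^ 4 * Real.log N ^ 2) := by ring
        _ ≤ cη ^ 4 * (Real.log N ^ A₀) ^ 2 := mul_le_mul_of_nonneg_left hsq (by positivity)
    calc ρ₁ * (4 * ((2 : ℝ) ^ j) ^ 2) / Real.log N ^ A₀
        = 4 * (ρ₁ / Real.log N ^ A₀) * ((2 : ℝ) ^ j) ^ 2 := by ring
      _ ≤ 4 * ((Real.log N ^ A₀)⁻¹ * (Real.log N ^ A₀)⁻¹) * ((2 : ℝ) ^ j) ^ 2 := by gcongr
      _ ≤ cη ^ 4 * (Real.log N ^ aη)⁻¹ ^ 4 * ((2 : ℝ) ^ j) ^ 2 :=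
          mul_le_mul_of_nonneg_right hmain (by positivity)
      _ ≤ η ^ 4 * ((2 : ℝ) ^ j) ^ 2 := mul_le_mul_of_nonneg_right hη4 (by positivity)
      _ = (η ^ 2 * 2 ^ j) ^ 2 := by ring
  -- Lemma 23 at one scale
  exact hTI N hN1 α n₀ (100 * ρ) ρ ε φ hφ hεpos hR ψ hψ0 hψ1 hsupp hsuppN hlip η hηpos hη2 h16
    U j hUN hgood (Real.log N ^ A₀) ρ₁ hρ₁pos hρ₁ε hB1 hB2 hsize hdens

end Summit.Parity.GeneralizedHardyLittlewood.GreenTaoLevelTwoMNTwoTypeIHalf
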